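import Mathlib
import Summits.Ventures.PercRepro2.ZCPendantTransfer

/-!
# Pinning two edges (blind cell PercRepro2, p5 g31)

For two distinct edges `e₁, e₂` write `ω₀₀ := ω[e₁ ↦ false][e₂ ↦ false]` and, for an event `H`,
`pinned e₁ e₂ H := {ω | ω₀₀ ∈ H}` — «`H` holds once both edges are closed».  The event
`pinned e₁ e₂ H` does not depend on the states of `e₁, e₂`, so its probability under any weights
equals the probability of `H` under the weights with `e₁, e₂` pinned closed
(**`prob_pinned`**), and the four edge patterns factor (**`prob_open_open_pinned`**, …):
`P(e₁ open, e₂ open, ω₀₀ ∈ H) = p e₁ · p e₂ · P_{p[e₁↦0][e₂↦0]}(H)`, etc.  Own work; standard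
axioms.
-/

namespace Summit.Ventures.PercRepro2

namespace PinTwo

section Config

variable {E : Type*} [DecidableEq E]

/-- `ω₀₀ := ω[e₁ ↦ false][e₂ ↦ false]`. -/
def close2 (e₁ e₂ : E) (ω : Config E) : Config E :=
  Function.update (Function.update ω e₁ false) e₂ false

/-- `{ω | ω₀₀ ∈ H}`: the event `H` read on the configuration with `e₁, e₂` closed. -/
def pinned (e₁ e₂ : E) (H : Set (Config E)) : Set (Config E) := {ω | close2 e₁ e₂ ω ∈ H}

variable {e₁ e₂ : E}

/-- Membership in the pinned event. -/
lemma mem_pinned {H : Set (Config E)} {ω : Config E} :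
    ω ∈ pinned e₁ e₂ H ↔ close2 e₁ e₂ ω ∈ H := Iff.rfl

/-- `close2` is unchanged by an update of `e₁`. -/
lemma close2_update_left (ω : Config E) (c : Bool) :
    close2 e₁ e₂ (Function.update ω e₁ c) = close2 e₁ e₂ ω := by
  simp [close2, Function.update_idem]

/-- `close2` is unchanged by an update of `e₂`. -/
lemma close2_update_right (h12 : e₁ ≠ e₂) (ω : Config E) (c : Bool) :
    close2 e₁ e₂ (Function.update ω e₂ c) = close2 e₁ e₂ ω := by
  simp only [close2]
  rw [Function.update_comm h12.symm, Function.update_idem]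

/-- On configurations with both edges closed, `close2` is the identity. -/
lemma close2_eq_self {ω : Config E} (h1 : ω e₁ = false) (h2 : ω e₂ = false) :
    close2 e₁ e₂ ω = ω := by
  have i1 : Function.update ω e₁ false = ω := Function.update_eq_self_iff.2 h1.symm
  have i2 : Function.update ω e₂ false = ω := Function.update_eq_self_iff.2 h2.symm
  unfold close2
  rw [i1, i2]

end Config

section Prob

variable {E : Type*} [Fintype E] [DecidableEq E] {R : Type*} [Field R] {e₁ e₂ : E}

/-- Flipping `e₁` does not change the pinned event. -/
lemma prob_update_left_pinned (q : E → R) (H : Set (Config E)) :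
    prob (Function.update q e₁ 1) (pinned e₁ e₂ H) = prob (Function.update q e₁ 0) (pinned e₁ e₂ H) :=
  ZCPendant.prob_update_one_eq_update_zero q fun ω => by
    simp only [mem_pinned, close2_update_left]

/-- Flipping `e₂` does not change the pinned event. -/
lemma prob_update_right_pinned (h12 : e₁ ≠ e₂) (q : E → R) (H : Set (Config E)) :
    prob (Function.update q e₂ 1) (pinned e₁ e₂ H) = prob (Function.update q e₂ 0) (pinned e₁ e₂ H) :=
  ZCPendant.prob_update_one_eq_update_zero q fun ω => by
    simp only [mem_pinned, close2_update_right h12]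

/-- Under `q[e₁↦0][e₂↦0]` the pinned event and `H` agree. -/
lemma prob_closed_pinned (h12 : e₁ ≠ e₂) (q : E → R) (H : Set (Config E)) :
    prob (Function.update (Function.update q e₁ 0) e₂ 0) (pinned e₁ e₂ H) =
      prob (Function.update (Function.update q e₁ 0) e₂ 0) H := by
  have e1 : ∀ A : Set (Config E), prob (Function.update (Function.update q e₁ 0) e₂ 0) A =
      prob (Function.update (Function.update q e₁ 0) e₂ 0) (A ∩ closedEdge e₁ ∩ closedEdge e₂) := by
    intro A
    have s2 := prob_update_zero_inter_closedEdge (Function.update q e₁ 0) (A ∩ closedEdge e₁) e₂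
    have s1 := prob_update_zero_inter_closedEdge (Function.update q e₂ 0) A e₁
    rw [Function.update_comm h12.symm] at s1
    rw [s2, s1]
  rw [e1 (pinned e₁ e₂ H), e1 H]
  congr 1
  ext ω
  simp only [Set.mem_inter_iff, mem_pinned, closedEdge, Set.mem_setOf_eq]
  constructor
  · rintro ⟨⟨h, h1⟩, h2⟩
    rw [close2_eq_self h1 h2] at h
    exact ⟨⟨h, h1⟩, h2⟩
  · rintro ⟨⟨h, h1⟩, h2⟩
    rw [close2_eq_self h1 h2]
    exact ⟨⟨h, h1⟩, h2⟩

/-- **The pinned event's probability**: `P_q(ω₀₀ ∈ H) = P_{q[e₁↦0][e₂↦0]}(H)` for every `q`. -/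
theorem prob_pinned (h12 : e₁ ≠ e₂) (q : E → R) (H : Set (Config E)) :
    prob q (pinned e₁ e₂ H) = prob (Function.update (Function.update q e₁ 0) e₂ 0) H := by
  rw [prob_eq_pin q _ e₁, prob_update_left_pinned, ← add_mul, add_sub_cancel, one_mul,
    prob_eq_pin _ _ e₂, prob_update_right_pinned h12, ← add_mul, add_sub_cancel, one_mul,
    prob_closed_pinned h12]

/-- `P(e₁ open, e₂ open, ω₀₀ ∈ H) = p e₁ · p e₂ · P_{p[e₁↦0][e₂↦0]}(H)`. -/
theorem prob_open_open_pinned (h12 : e₁ ≠ e₂) (p : E → R) (H : Set (Config E)) :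
    prob p (openEdge e₁ ∩ openEdge e₂ ∩ pinned e₁ e₂ H) =
      p e₁ * p e₂ * prob (Function.update (Function.update p e₁ 0) e₂ 0) H := by
  rw [Set.inter_assoc, Set.inter_comm, prob_inter_openEdge, Set.inter_comm, prob_inter_openEdge,
    Function.update_of_ne h12.symm, prob_pinned h12, Function.update_comm h12.symm,
    Function.update_idem, Function.update_idem]
  ring

/-- `P(e₁ closed, e₂ open, ω₀₀ ∈ H) = (1 − p e₁) · p e₂ · P_{p[e₁↦0][e₂↦0]}(H)`. -/
theorem prob_closed_open_pinned (h12 : e₁ ≠ e₂) (p : E → R) (H : Set (Config E)) :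
    prob p (closedEdge e₁ ∩ openEdge e₂ ∩ pinned e₁ e₂ H) =
      (1 - p e₁) * p e₂ * prob (Function.update (Function.update p e₁ 0) e₂ 0) H := by
  rw [Set.inter_assoc, Set.inter_comm, prob_inter_closedEdge, Set.inter_comm, prob_inter_openEdge,
    Function.update_of_ne h12.symm, prob_pinned h12, Function.update_comm h12.symm,
    Function.update_idem, Function.update_idem]
  ring

/-- `P(e₁ open, e₂ closed, ω₀₀ ∈ H) = p e₁ · (1 − p e₂) · P_{p[e₁↦0][e₂↦0]}(H)`. -/
theorem prob_open_closed_pinned (h12 : e₁ ≠ e₂) (p : E → R) (H : Set (Config E)) :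
    prob p (openEdge e₁ ∩ closedEdge e₂ ∩ pinned e₁ e₂ H) =
      p e₁ * (1 - p e₂) * prob (Function.update (Function.update p e₁ 0) e₂ 0) H := by
  rw [Set.inter_assoc, Set.inter_comm, prob_inter_openEdge, Set.inter_comm, prob_inter_closedEdge,
    Function.update_of_ne h12.symm, prob_pinned h12, Function.update_comm h12.symm,
    Function.update_idem, Function.update_idem]
  ring

/-- `P(e₁ closed, ω₀₀ ∈ H) = (1 − p e₁) · P_{p[e₁↦0][e₂↦0]}(H)`. -/
theorem prob_closed_pinned' (h12 : e₁ ≠ e₂) (p : E → R) (H : Set (Config E)) :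
    prob p (closedEdge e₁ ∩ pinned e₁ e₂ H) =
      (1 - p e₁) * prob (Function.update (Function.update p e₁ 0) e₂ 0) H := by
  rw [Set.inter_comm, prob_inter_closedEdge, prob_pinned h12]
  simp only [Function.update_idem]

/-- `P(e₁ open, ω₀₀ ∈ H) = p e₁ · P_{p[e₁↦0][e₂↦0]}(H)`. -/
theorem prob_open_pinned' (h12 : e₁ ≠ e₂) (p : E → R) (H : Set (Config E)) :
    prob p (openEdge e₁ ∩ pinned e₁ e₂ H) =
      p e₁ * prob (Function.update (Function.update p e₁ 0) e₂ 0) H := by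
  rw [Set.inter_comm, prob_inter_openEdge, prob_pinned h12]
  simp only [Function.update_idem]

/-- `P(e₂ open, ω₀₀ ∈ H) = p e₂ · P_{p[e₁↦0][e₂↦0]}(H)`. -/
theorem prob_open_pinned'' (h12 : e₁ ≠ e₂) (p : E → R) (H : Set (Config E)) :
    prob p (openEdge e₂ ∩ pinned e₁ e₂ H) =
      p e₂ * prob (Function.update (Function.update p e₁ 0) e₂ 0) H := by
  rw [Set.inter_comm, prob_inter_openEdge, prob_pinned h12, Function.update_comm h12.symm,
    Function.update_idem]

end Prob

end PinTwo

end Summit.Ventures.PercRepro2
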